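import Literature.MathematicalPhysics.QuantumFieldTheory.Balaban1983to89.B4Eq212SmallR

/-!
# `Balaban1983to89.B4Ineq110WalkRoute` — [Balaban1983RegularityDecay] THEOREM (1.10), value member
# «|(G_k(Ω,A)f)(x)| ≤ c₀exp(−δ₀dist(x, supp f))‖f‖_∞», BY THE PRINTED §2 WALK ROUTE END TO END on the concrete
# operators, for EVERY region and EVERY configuration `A`, modulo the two per-cube inputs (sup bound of the cube
# propagators, the (2.20) factor bound with the choice (2.21) of `M`)

statement-level skeleton of published theorems with citation tags; proofs where landed; nothing here is a claim about the Yang–Mills mass gap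

CITATION HEADER.  T. Bałaban, *Regularity and decay of lattice Green's functions*, Commun. Math. Phys. **89** (1983)
571–597, doi:10.1007/bf01214744 [Balaban1983RegularityDecay] (cell paper B4; held text
`paper:balaban1983-cmp89-regularity-decay`, journal page = PDF page + 570; pp. 573, 575–579).  Unit `lit-balaban-r01`
gen 5 (B4 fold owner), HOME `run/shared/lean/pub/lit-balaban/`, SKELETON rows **B4.Thm@573** ((1.9)–(1.12); this file:
the value member of (1.10)), **B4.Eq2.12**, **B4.Eq2.18**.  Theorems only; imports `B4Eq212SmallR` (→ `B4Eq213ConcreteWalk`,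
`B4LpChain221`).  Norm: Mathlib's scope `Matrix.Norms.Operator` (`‖A‖ = max_i Σ_j |A_{ij}|`, the `ℓ^∞ → ℓ^∞` operator
norm, i.e. the `L^∞` operator norm of (2.20)).

WHAT IS PRINTED (verbatim, p. 573).  *«Theorem (Proposition 2.1 of [1]). For α < 1 there exist positive constants
δ₀, c₀, R₀ independent of A, k, Ω and depending on d, M only, c₀ on α also, such that for e sufficiently small and for
an arbitrary function f : Ω → R^N, we have … (1.9) … Similarly |(D^η_{A,μ}G_k(Ω,A)f)(x)|, |(G_k(Ω,A)f)(x)| ≤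
c₀exp(−δ₀dist(x, supp f))‖f‖_∞ (1.10) for x ∈ Ω, dist(x, Ω^c) ≥ R₀. … For some simple sets Ω, e.g. for rectangular
parallelepipeds, the inequalities hold without any restrictions on the points x, x′, i.e. for all x, x′ ∈ Ω.»*;
p. 579: *«Thus we have reduced it to Lemmas 2.1, 2.2»*.

WHAT THIS MODULE PROVES (all in full).
* §1–§2 plumbing for the `ℓ^∞`-operator norm: `norm_le_of_neumann` (`G(1 − R) = G₀`, `‖R‖ < 1` ⇒
  `‖G‖ ≤ ‖G₀‖/(1 − ‖R‖)`, the size of (2.12)), `mulH_apply`/`mulH_mul_apply`/`mul_mulH_apply`/`mulH_mulVec_apply`,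
  `norm_mulH_le`, `mulH_eq_zero_of`.
* **`ineq110_value`** — for [B4]'s concrete operators (`H = covOp c m² a q W T` (1.6) with data local at scale `M/8`
  and its inverse `G`; labels `s ⊇` the support; Neumann-cut cube operators `H_j` (2.6) with inverses `G_j`; the
  CONSTRUCTED partition of unity `h_j` of `B4PartitionUnity22`) and the two analytic inputs
  `γ ≥ ‖G_j‖` (Lemma 2.2 (2.17) at `p = q = ∞` for the cubes) and `β ≥ ‖K_jG_jh_j‖` with `3^dβ ≤ e⁻¹` (the factor
  bound (2.20) with the choice (2.21) of `M`): for every site `x`, every site set `F` and every `D ≤ dist_∞(x, F)`,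
  `‖1_x·G·1_F‖ ≤ 2^{d+1}e^{9/4}γ·e^{−D/M}`.  Far from `F` (`D ≥ (9/4)M`) this is the walk expansion (2.13) with at
  most `2^d` starting cubes and label separation `⌊D/M − 5/4⌋` (`B4Eq212SmallR.concrete_walk_decay_exp`); near `F`
  it is the Neumann-series size `‖G‖ ≤ 2‖G₀‖ ≤ 2^{d+1}γ` (`‖G₀‖ ≤ 2^dγ` by row multiplicity, `‖R‖ ≤ 2^dβ ≤ 1/2`).
* **`ineq110_value_apply`** — the printed shape: `|(G_k(Ω,A)f)(x)| ≤ c₀e^{−δ₀D}·sup|f|` for `f` supported in `F`,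
  `c₀ = 2^{d+1}e^{9/4}γ`, `δ₀ = M⁻¹`, `D ≤ dist_∞(x, F)`; **`kernel_decay_110`** — `|G_k(Ω,A; x,x′)| ≤ c₀e^{−D/M}`,
  `D ≤ |x − x′|_∞`.

HONEST SCOPE.  (i) Only the VALUE member of (1.10); the derivative member and the Hölder bound (1.9) need the
`D^η`-factor bounds of Lemma 2.1/2.2 and are not treated here.  (ii) The print's restriction `dist(x, Ω^c) ≥ R₀` is
absent because the sup factor bounds `γ, β` are ASSUMED for every cube, boundary cubes included — the print has only
Lemma 2.1's `L²` bounds there and runs the `L^p` chain (2.18)–(2.21) (`B4LpChain221`); for rectangular `Ω` the print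
itself lifts the restriction (quoted above).  (iii) `γ, β` are hypotheses: proving them at `A ≠ 0` is Lemmas 2.1/2.2 at
`Ã_j` (the cell's reserve item R9); at zero field on boxes see `B4Eq220PartitionSizes.eq220_hBox` and the lineage's
`B4Lemma22*`/`B4Thm110ZeroBox`.  No `def`, no `Prop` fact, no `sorry`; axioms standard.
-/

namespace Literature.MathematicalPhysics.QuantumFieldTheory.Balaban1983to89.B4Ineq110WalkRoute

open Literature.MathematicalPhysics.QuantumFieldTheory.Balaban1983to89.B4GaugeCovariance
open Literature.MathematicalPhysics.QuantumFieldTheory.Balaban1983to89.B4Commutators25to211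
open Literature.MathematicalPhysics.QuantumFieldTheory.Balaban1983to89.B4PartitionUnity22
open Literature.MathematicalPhysics.QuantumFieldTheory.Balaban1983to89.B4RandomWalk213
open Literature.MathematicalPhysics.QuantumFieldTheory.Balaban1983to89.B4Eq26Locality
open Literature.MathematicalPhysics.QuantumFieldTheory.Balaban1983to89.B4Eq213ConcreteWalk
open Literature.MathematicalPhysics.QuantumFieldTheory.Balaban1983to89.B4Eq212SmallR
open scoped Matrix NNReal

open scoped Matrix.Norms.Operator

/-! ## §1. `ℓ^∞`-operator-norm plumbing: rows, entries, `A·f`, the Neumann series -/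

section Norm

variable {m n : Type*} [Fintype m] [Fintype n]

/-- a row sum is at most the `ℓ^∞`-operator norm. [folklore] -/
private theorem row_sum_le_norm (A : Matrix m n ℝ) (i : m) : ∑ j, |A i j| ≤ ‖A‖ := by
  rw [Matrix.linfty_opNorm_def]
  have h : (∑ j, ‖A i j‖₊ : ℝ≥0) ≤ Finset.univ.sup fun i => ∑ j, ‖A i j‖₊ :=
    Finset.le_sup (f := fun i => ∑ j, ‖A i j‖₊) (Finset.mem_univ i)
  have h' := NNReal.coe_le_coe.mpr h
  simp only [NNReal.coe_sum, coe_nnnorm, Real.norm_eq_abs] at h'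
  exact h'

/-- the `ℓ^∞`-operator norm is bounded by any common bound of the row sums. [folklore] -/
private theorem norm_le_of_rows (A : Matrix m n ℝ) {C : ℝ} (hC : 0 ≤ C) (h : ∀ i, ∑ j, |A i j| ≤ C) :
    ‖A‖ ≤ C := by
  rw [Matrix.linfty_opNorm_def]
  have : (Finset.univ.sup fun i => ∑ j, ‖A i j‖₊ : ℝ≥0) ≤ C.toNNReal := by
    refine Finset.sup_le fun i _ => ?_
    rw [← NNReal.coe_le_coe, Real.coe_toNNReal C hC]
    simp only [NNReal.coe_sum, coe_nnnorm, Real.norm_eq_abs]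
    exact h i
  have h2 := NNReal.coe_le_coe.mpr this
  rwa [Real.coe_toNNReal C hC] at h2

/-- an entry is at most the `ℓ^∞`-operator norm. [folklore] -/
private theorem entry_le_norm (A : Matrix m n ℝ) (i : m) (j : n) : |A i j| ≤ ‖A‖ :=
  (Finset.single_le_sum (f := fun j => |A i j|) (fun _ _ => abs_nonneg _) (Finset.mem_univ j)).trans
    (row_sum_le_norm A i)

/-- `|(Af)_i| ≤ ‖A‖·sup|f|`. [folklore] -/
private theorem abs_mulVec_le (A : Matrix m n ℝ) (f : n → ℝ) {φ : ℝ} (hφ : 0 ≤ φ) (hf : ∀ j, |f j| ≤ φ)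
    (i : m) : |(A *ᵥ f) i| ≤ ‖A‖ * φ := by
  rw [Matrix.mulVec, dotProduct]
  calc |∑ j, A i j * f j| ≤ ∑ j, |A i j * f j| := Finset.abs_sum_le_sum_abs _ _
    _ ≤ ∑ j, |A i j| * φ := Finset.sum_le_sum fun j _ => by
        rw [abs_mul]; exact mul_le_mul_of_nonneg_left (hf j) (abs_nonneg _)
    _ = (∑ j, |A i j|) * φ := by rw [Finset.sum_mul]
    _ ≤ ‖A‖ * φ := mul_le_mul_of_nonneg_right (row_sum_le_norm A i) hφ

/-- `‖1‖ ≤ 1` in the `ℓ^∞`-operator norm (`= 1` unless the index type is empty). [folklore] -/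
private theorem norm_one_le [DecidableEq m] : ‖(1 : Matrix m m ℝ)‖ ≤ 1 := by
  refine norm_le_of_rows _ zero_le_one fun i => ?_
  rw [Finset.sum_eq_single i]
  · simp
  · intro j _ hji; rw [Matrix.one_apply_ne' hji, abs_zero]
  · intro h; exact absurd (Finset.mem_univ i) h

/-- `‖Rⁿ‖ ≤ ‖R‖ⁿ` (all `n`, thanks to `‖1‖ ≤ 1`). [folklore] -/
private theorem norm_pow_le_pow [DecidableEq m] (R : Matrix m m ℝ) : ∀ k : ℕ, ‖R ^ k‖ ≤ ‖R‖ ^ k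
  | 0 => by rw [pow_zero, pow_zero]; exact norm_one_le
  | k + 1 => by
      rw [pow_succ, pow_succ]
      exact (norm_mul_le _ _).trans (mul_le_mul_of_nonneg_right (norm_pow_le_pow R k) (norm_nonneg _))

/-- **the size of the Neumann series (2.12)**: `‖G‖ ≤ ‖G₀‖/(1 − ‖R‖)` from `G(1 − R) = G₀` and `‖R‖ < 1`.
[cite: Balaban1983RegularityDecay, (2.12) p.577] -/
theorem norm_le_of_neumann [DecidableEq m] {G G₀ Rop : Matrix m m ℝ} (hR : ‖Rop‖ < 1)
    (hG : G * (1 - Rop) = G₀) : ‖G‖ ≤ ‖G₀‖ * (1 - ‖Rop‖)⁻¹ := by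
  haveI : CompleteSpace (Matrix m m ℝ) := FiniteDimensional.complete ℝ (Matrix m m ℝ)
  have h2 : (1 - Rop) * ∑' k : ℕ, Rop ^ k = 1 := mul_neg_geom_series Rop hR
  have hGeq : G = G₀ * ∑' k : ℕ, Rop ^ k := by rw [← hG, mul_assoc, h2, mul_one]
  have hT : ‖∑' k : ℕ, Rop ^ k‖ ≤ (1 - ‖Rop‖)⁻¹ :=
    tsum_of_norm_bounded (hasSum_geometric_of_lt_one (norm_nonneg _) hR) (norm_pow_le_pow Rop)
  rw [hGeq]
  exact (norm_mul_le _ _).trans (mul_le_mul_of_nonneg_left hT (norm_nonneg _))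

end Norm

/-! ## §2. The multiplication operators `mulH g`: entries, products, norm, vanishing -/

section MulH

variable {X κ : Type*} [Fintype X] [Fintype κ] [DecidableEq X] [DecidableEq κ]

omit [Fintype X] [Fintype κ] in
/-- the entries of [B4]'s multiplication operator `mulH g` (`φ ↦ gφ`): `g(z)` on the diagonal, `0` elsewhere.
[cite: Balaban1983RegularityDecay, (2.2)–(2.5) pp. 575–576] -/
theorem mulH_apply (g : X → ℝ) (p p' : X × κ) : mulH (ι := κ) g p p' = if p = p' then g p.1 else 0 := by
  unfold mulH blockDiag
  rw [blockOp_apply]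
  obtain ⟨z, k⟩ := p
  obtain ⟨z', k'⟩ := p'
  by_cases h1 : z = z'
  · subst h1
    simp only [if_true, Matrix.smul_apply, smul_eq_mul, Matrix.one_apply, Prod.mk.injEq, true_and, mul_ite,
      mul_one, mul_zero]
  · simp only [h1, if_false, Matrix.zero_apply, Prod.mk.injEq, false_and]

/-- `(mulH g · A)(p, t) = g(p₁)·A(p, t)` (left multiplication by `g` scales kernel rows). [cite: Balaban1983RegularityDecay, (2.2)–(2.5) pp. 575–576] -/
theorem mulH_mul_apply {T : Type*} (g : X → ℝ) (A : Matrix (X × κ) T ℝ) (p : X × κ) (t : T) :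
    (mulH (ι := κ) g * A) p t = g p.1 * A p t := by
  rw [Matrix.mul_apply]
  simp_rw [mulH_apply, ite_mul, zero_mul]
  rw [Finset.sum_ite_eq]
  simp

/-- `(A · mulH g)(t, p) = A(t, p)·g(p₁)` (right multiplication by `g` scales kernel columns). [cite: Balaban1983RegularityDecay, (2.2)–(2.5) pp. 575–576] -/
theorem mul_mulH_apply {T : Type*} (A : Matrix T (X × κ) ℝ) (g : X → ℝ) (t : T) (p : X × κ) :
    (A * mulH (ι := κ) g) t p = A t p * g p.1 := by
  rw [Matrix.mul_apply]
  simp_rw [mulH_apply, mul_ite, mul_zero]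
  rw [Finset.sum_ite_eq']
  simp

/-- `(mulH g · f)(p) = g(p₁)·f(p)` — «φ ↦ h_jφ». [cite: Balaban1983RegularityDecay, (2.2)–(2.5) pp. 575–576] -/
theorem mulH_mulVec_apply (g : X → ℝ) (f : X × κ → ℝ) (p : X × κ) :
    (mulH (ι := κ) g *ᵥ f) p = g p.1 * f p := by
  rw [Matrix.mulVec, dotProduct]
  simp_rw [mulH_apply, ite_mul, zero_mul]
  rw [Finset.sum_ite_eq]
  simp

/-- `‖mulH g‖ ≤ sup|g|` in the `ℓ^∞`-operator norm (the multiplications by `h_j`, `|h_j| ≤ 1`, cost nothing in (2.20)).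
[cite: Balaban1983RegularityDecay, (2.20) p.578] -/
theorem norm_mulH_le (g : X → ℝ) {C : ℝ} (hC : 0 ≤ C) (hg : ∀ z, |g z| ≤ C) : ‖mulH (ι := κ) g‖ ≤ C := by
  refine norm_le_of_rows _ hC fun p => ?_
  have : ∀ p', |mulH (ι := κ) g p p'| = if p = p' then |g p.1| else 0 := by
    intro p'
    rw [mulH_apply]
    split_ifs
    · rfl
    · exact abs_zero
  simp_rw [this]
  rw [Finset.sum_ite_eq]
  simpa using hg p.1

omit [Fintype X] [Fintype κ] in
/-- `mulH` of a function vanishing everywhere is `0` (support cut-offs `1_x·h_j = 0` off `supp h_j`). [cite: Balaban1983RegularityDecay, (2.2)–(2.5) pp. 575–576] -/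
theorem mulH_eq_zero_of {g : X → ℝ} (hg : ∀ z, g z = 0) : mulH (ι := κ) g = 0 := by
  have : g = 0 := funext hg
  subst this
  exact mulH_zero

end MulH

/-! ## §3. THEOREM (1.10), value member, by the walk route of §2 — for EVERY `Ω` and `A`, modulo the two per-cube
inputs `γ` (sup-norm bound of the cube propagators) and `β` (the (2.20) factor bound) -/

section Route

variable {X Y κ : Type*} [Fintype X] [Fintype Y] [Fintype κ] [DecidableEq X] [DecidableEq κ] {d : ℕ}

/-- the labels that can see the site `x` (`h_j(x) ≠ 0`) number at most `2^d`. [cite: Balaban1983RegularityDecay, §2 p.575] -/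
private theorem card_labelBox_le (M : ℝ) (x : Fin d → ℝ) :
    (Fintype.piFinset fun μ => ({⌊x μ / M⌋, ⌊x μ / M⌋ + 1} : Finset ℤ)).card ≤ 2 ^ d := by
  rw [Fintype.card_piFinset]
  calc ∏ μ, ({⌊x μ / M⌋, ⌊x μ / M⌋ + 1} : Finset ℤ).card ≤ 2 ^ (Finset.univ : Finset (Fin d)).card :=
        Finset.prod_le_pow_card _ _ 2 fun μ _ => Finset.card_le_two
    _ = 2 ^ d := by rw [Finset.card_univ, Fintype.card_fin]

/-- `e⁻¹ ≤ 1/2`. [folklore] -/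
private theorem exp_neg_one_le_half : Real.exp (-1) ≤ 1 / 2 := by
  have h := Real.add_one_le_exp (1 : ℝ)
  rw [Real.exp_neg, inv_eq_one_div]
  exact one_div_le_one_div_of_le (by norm_num) (by linarith)

/-- **THEOREM (1.10), VALUE MEMBER, FOR `G_k(Ω,A)` ITSELF — the §2 walk route end to end on [B4]'s concrete
operators, for EVERY finite region and EVERY configuration `A`, with the two analytic inputs explicit**:
if every cube propagator `G_j` (inverse of the Neumann-cut operator `H_j`, (2.6)) has `ℓ^∞`-operator norm `≤ γ`
(Lemma 2.2 (2.17) at `p = q = ∞` for the cubes `□_j` at `Ã_j`) and every factor `K_jG_jh_j` has norm `≤ β` with the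
printed choice of `M` (2.21), `3^dβ ≤ e⁻¹`, then for every site `x`, every site set `F` and every real `D` with
`D ≤ |x − x′|_∞` for all `x′ ∈ F` (`D ↦ dist(x, supp f)`):
`‖1_x · G_k(Ω,A) · 1_F‖_∞→∞ ≤ 2^{d+1}e^{9/4}·γ·e^{−D/M}` — i.e. «|(G_k(Ω,A)f)(x)| ≤ c₀e^{−δ₀dist(x, supp f)}‖f‖_∞»
with `c₀ = 2^{d+1}e^{9/4}γ`, `δ₀ = M⁻¹` (sup-distance in the units of `pos`).  Far from `supp f` this is the walk bound
(2.13)/(2.22) (`B4Eq212SmallR.concrete_walk_decay_exp` with `P = 1_x`, `P′ = 1_F`, at most `2^d` starting cubes,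
label separation `⌊D/M − 5/4⌋`); near `supp f` it is the size of the Neumann series, `‖G‖ ≤ ‖G₀‖/(1 − ‖R‖) ≤ 2^{d+1}γ`.
HONEST SCOPE: the print restricts to `dist(x, Ω^c) ≥ R₀` because boundary cubes only carry Lemma 2.1's `L²` bounds
(handled by the `L^p` chain (2.18)–(2.21), `B4LpChain221`); here the sup factor bounds are ASSUMED for every cube,
which the print grants without restriction for rectangular `Ω` (p. 573 «For some simple sets Ω, e.g. for rectangular
parallelepipeds, the inequalities hold without any restrictions on the points x, x′»).
[cite: Balaban1983RegularityDecay, Theorem (1.10) p.573; (2.12)–(2.13) p.577; (2.20)–(2.22) pp.578–579] -/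
theorem ineq110_value {M : ℝ} (hM : 0 < M) (pos : X → Fin d → ℝ) (c : X → X → ℝ) (m2 a : ℝ)
    (q : Y → X → ℝ) (W : X → X → Matrix κ κ ℝ) (T : Y → X → Matrix κ κ ℝ)
    (hc : ∀ x z', c x z' ≠ 0 → ∀ μ, |pos x μ - pos z' μ| ≤ 1 / 8 * M)
    (hq : ∀ y x z', q y x ≠ 0 → q y z' ≠ 0 → ∀ μ, |pos x μ - pos z' μ| ≤ 1 / 8 * M)
    (s : Finset (Fin d → ℤ)) (hs : ∀ j x, hCube M j (pos x) ≠ 0 → j ∈ s)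
    (S : (Fin d → ℤ) → X → Prop) [∀ j, DecidablePred (S j)]
    (hS : ∀ j z, (∀ μ, |pos z μ - M * j μ| ≤ 7 / 8 * M) → S j z)
    (W' : (Fin d → ℤ) → X → X → Matrix κ κ ℝ) (T' : (Fin d → ℤ) → Y → X → Matrix κ κ ℝ)
    (hWW' : ∀ j x z', (∀ μ, |pos x μ - M * j μ| ≤ 3 / 4 * M) → (∀ μ, |pos z' μ - M * j μ| ≤ 3 / 4 * M) →
      W' j x z' = W x z')
    (hTT' : ∀ j y x, q y x ≠ 0 → (∀ μ, |pos x μ - M * j μ| ≤ 3 / 4 * M) → T' j y x = T y x)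
    (Gj : (Fin d → ℤ) → Matrix (X × κ) (X × κ) ℝ)
    (hGj : ∀ j ∈ s, covOp (fun z z' => if (S j z ↔ S j z') then c z z' else 0) m2 a q (W' j) (T' j) * Gj j = 1)
    (G : Matrix (X × κ) (X × κ) ℝ) (hGH : G * covOp c m2 a q W T = 1)
    -- the two analytic inputs
    {γ β : ℝ} (hγ0 : 0 ≤ γ) (hγ : ∀ i : ↥s, ‖Gj i.1‖ ≤ γ) (hβ0 : 0 ≤ β)
    (hβ : ∀ i : ↥s, ‖opK (fun z z' => if (S i.1 z ↔ S i.1 z') then c z z' else 0) m2 a q (W' i.1) (T' i.1)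
        (fun z => hCube M i.1 (pos z)) * Gj i.1 * mulH (ι := κ) (fun z => hCube M i.1 (pos z))‖ ≤ β)
    (h3β : (3 : ℝ) ^ d * β ≤ Real.exp (-1))
    -- the site, the support set and their separation
    (x : X) (F : X → Prop) [DecidablePred F] {D : ℝ} (hD : ∀ x', F x' → ∃ μ, D ≤ |pos x μ - pos x' μ|) :
    ‖mulH (ι := κ) (fun z => if z = x then (1 : ℝ) else 0) * G * mulH (ι := κ) (fun z => if F z then (1 : ℝ) else 0)‖
      ≤ 2 ^ (d + 1) * Real.exp (9 / 4) * γ * Real.exp (-(D / M)) := by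
  classical
  -- the letters
  set h : (Fin d → ℤ) → X → ℝ := fun j z => hCube M j (pos z) with hh
  set cut : (Fin d → ℤ) → X → X → ℝ := fun j z z' => if (S j z ↔ S j z') then c z z' else 0 with hcut
  set aJ : (Fin d → ℤ) → Matrix (X × κ) (X × κ) ℝ :=
    fun j => mulH (ι := κ) (h j) * Gj j * mulH (ι := κ) (h j) with haJ
  set bJ : (Fin d → ℤ) → Matrix (X × κ) (X × κ) ℝ :=
    fun j => opK (cut j) m2 a q (W' j) (T' j) (h j) * Gj j * mulH (ι := κ) (h j) with hbJ
  set P : Matrix (X × κ) (X × κ) ℝ := mulH (ι := κ) (fun z => if z = x then (1 : ℝ) else 0) with hPdef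
  set P' : Matrix (X × κ) (X × κ) ℝ := mulH (ι := κ) (fun z => if F z then (1 : ℝ) else 0) with hP'def
  -- sizes of the letters
  have hh1 : ∀ j z, |h j z| ≤ 1 := fun j z =>
    abs_le.mpr ⟨by linarith [hCube_nonneg M j (pos z)], hCube_le_one M j (pos z)⟩
  have hnH : ∀ j, ‖mulH (ι := κ) (h j)‖ ≤ 1 := fun j => norm_mulH_le _ zero_le_one (hh1 j)
  have hnP : ‖P‖ ≤ 1 := norm_mulH_le _ zero_le_one fun z => by
    by_cases hz : z = x <;> simp [hz]
  have hnP' : ‖P'‖ ≤ 1 := norm_mulH_le _ zero_le_one fun z => by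
    by_cases hz : F z <;> simp [hz]
  have hnA : ∀ j : ↥s, ‖aJ j.1‖ ≤ γ := by
    intro j
    calc ‖aJ j.1‖ ≤ ‖mulH (ι := κ) (h j.1) * Gj j.1‖ * ‖mulH (ι := κ) (h j.1)‖ := norm_mul_le _ _
      _ ≤ (‖mulH (ι := κ) (h j.1)‖ * ‖Gj j.1‖) * ‖mulH (ι := κ) (h j.1)‖ :=
          mul_le_mul_of_nonneg_right (norm_mul_le _ _) (norm_nonneg _)
      _ ≤ (1 * γ) * 1 :=
          mul_le_mul (mul_le_mul (hnH j.1) (hγ j) (norm_nonneg _) zero_le_one) (hnH j.1) (norm_nonneg _)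
            (by rw [one_mul]; exact hγ0)
      _ = γ := by ring
  -- `‖R‖ ≤ 2^dβ ≤ 3^dβ ≤ e⁻¹ ≤ 1/2`
  have hR2 : ‖∑ j ∈ s, bJ j‖ ≤ (2 : ℝ) ^ d * β := norm_R_le hM pos c m2 a q hc hq s S W' T' Gj hβ0 hβ
  have h23 : (2 : ℝ) ^ d * β ≤ (3 : ℝ) ^ d * β :=
    mul_le_mul_of_nonneg_right (pow_le_pow_left₀ (by norm_num) (by norm_num) d) hβ0
  have hRhalf : ‖∑ j ∈ s, bJ j‖ ≤ 1 / 2 := (hR2.trans h23).trans (h3β.trans exp_neg_one_le_half)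
  have hRlt : ‖∑ j ∈ s, bJ j‖ < 1 := hRhalf.trans_lt (by norm_num)
  -- (2.9)–(2.12): `G(1 − R) = G₀`, so `‖G‖ ≤ ‖G₀‖/(1 − ‖R‖) ≤ 2·‖G₀‖ ≤ 2^{d+1}γ`
  have h211 : covOp c m2 a q W T * ∑ j ∈ s, aJ j = 1 - ∑ j ∈ s, bJ j :=
    parametrix_identity_hCube hM pos c m2 a q W T s hs S hS hc hq W' T' hWW' hTT' Gj hGj
  have hGeq : G * (1 - ∑ j ∈ s, bJ j) = ∑ j ∈ s, aJ j := G_mul_one_sub_eq hGH h211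
  have hG0 : ‖∑ j ∈ s, aJ j‖ ≤ (2 : ℝ) ^ d * γ := by
    have hmain := norm_sum_le_of_rowMult s aJ hγ0 (fun l hl => hnA ⟨l, hl⟩)
      (fun i : X × κ => Fintype.piFinset fun μ => ({⌊pos i.1 μ / M⌋, ⌊pos i.1 μ / M⌋ + 1} : Finset ℤ))
      (m₀ := 2 ^ d) (fun i => card_labelBox_le M (pos i.1))
      (by
        rintro ⟨z, k⟩ l _ hln p
        have hlz : h l z = 0 := by
          by_contra hne
          exact hln (mem_box_of_hCube_ne_zero hne)
        simp only [haJ]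
        rw [Matrix.mul_assoc, mulH_mul_apply, hlz, zero_mul])
    exact_mod_cast hmain
  have hG : ‖G‖ ≤ (2 : ℝ) ^ (d + 1) * γ := by
    have h1 := norm_le_of_neumann hRlt hGeq
    have hinv : (1 - ‖∑ j ∈ s, bJ j‖)⁻¹ ≤ 2 := (inv_le_comm₀ (by linarith) two_pos).mpr (by linarith)
    calc ‖G‖ ≤ ‖∑ j ∈ s, aJ j‖ * (1 - ‖∑ j ∈ s, bJ j‖)⁻¹ := h1
      _ ≤ ((2 : ℝ) ^ d * γ) * 2 :=
          mul_le_mul hG0 hinv (inv_nonneg.mpr (by linarith)) (by positivity)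
      _ = (2 : ℝ) ^ (d + 1) * γ := by ring
  -- the exponent bookkeeping
  have hexp : Real.exp (-1) * (2 * Real.exp 2 * Real.exp (-(D / M - 5 / 4)))
      = 2 * Real.exp (9 / 4) * Real.exp (-(D / M)) := by
    rw [show (9 / 4 : ℝ) = -1 + 2 + 5 / 4 by norm_num, Real.exp_add, Real.exp_add,
      show -(D / M - 5 / 4) = 5 / 4 + -(D / M) by ring, Real.exp_add]
    ring
  by_cases hfar : 1 ≤ ⌊D / M - 5 / 4⌋₊
  · -- FAR FROM THE SUPPORT: the walk bound with `N = ⌊D/M − 5/4⌋ ≥ 1` steps of separation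
    set N : ℕ := ⌊D / M - 5 / 4⌋₊ with hNdef
    have hDM : 1 ≤ D / M - 5 / 4 := by
      by_contra hlt
      rw [not_le] at hlt
      have : N = 0 := Nat.floor_eq_zero.mpr hlt
      omega
    have hNle : (N : ℝ) ≤ D / M - 5 / 4 := Nat.floor_le (by linarith)
    have hNlt : D / M - 5 / 4 < N + 1 := Nat.lt_floor_add_one _
    have hND : ((N : ℝ) + 5 / 4) * M ≤ D := by
      have : (N : ℝ) + 5 / 4 ≤ D / M := by linarith
      rwa [le_div_iff₀ hM] at this
    -- the starting and the final cubes
    set S₀ : Finset ↥s := Finset.univ.filter fun i : ↥s => h i.1 x ≠ 0 with hS₀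
    set S₁ : Finset ↥s := Finset.univ.filter fun i : ↥s => ∃ x', F x' ∧ h i.1 x' ≠ 0 with hS₁
    have hP : ∀ i : ↥s, i ∉ S₀ → P * aJ i.1 = 0 := by
      intro i hi
      have hix : h i.1 x = 0 := by
        by_contra hne
        exact hi (Finset.mem_filter.mpr ⟨Finset.mem_univ _, hne⟩)
      have hzero : P * mulH (ι := κ) (h i.1) = 0 := by
        rw [hPdef, mulH_mul_mulH]
        refine mulH_eq_zero_of fun z => ?_
        by_cases hz : z = x
        · rw [hz, hix, mul_zero]
        · rw [if_neg hz, zero_mul]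
      simp only [haJ]
      rw [← Matrix.mul_assoc, ← Matrix.mul_assoc, hzero, Matrix.zero_mul, Matrix.zero_mul]
    have hF0 : ∀ i : ↥s, i ∉ S₁ → mulH (ι := κ) (h i.1) * P' = 0 := by
      intro i hi
      rw [hP'def, mulH_mul_mulH]
      refine mulH_eq_zero_of fun z => ?_
      by_cases hz : F z
      · have hiz : h i.1 z = 0 := by
          by_contra hne
          exact hi (Finset.mem_filter.mpr ⟨Finset.mem_univ _, z, hz, hne⟩)
        rw [hiz, zero_mul]
      · rw [if_neg hz, mul_zero]
    have hP'a : ∀ i : ↥s, i ∉ S₁ → aJ i.1 * P' = 0 := by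
      intro i hi
      simp only [haJ]
      rw [Matrix.mul_assoc, hF0 i hi, Matrix.mul_zero]
    have hP'b : ∀ i : ↥s, i ∉ S₁ → bJ i.1 * P' = 0 := by
      intro i hi
      simp only [hbJ]
      rw [Matrix.mul_assoc, hF0 i hi, Matrix.mul_zero]
    have hα : ∀ i : ↥s, ‖P * aJ i.1‖ ≤ γ := fun i =>
      (norm_mul_le _ _).trans (by
        calc ‖P‖ * ‖aJ i.1‖ ≤ 1 * γ := mul_le_mul hnP (hnA i) (norm_nonneg _) zero_le_one
          _ = γ := one_mul γ)
    have hβ₁ : ∀ i : ↥s, ‖bJ i.1 * P'‖ ≤ β := fun i =>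
      (norm_mul_le _ _).trans (by
        calc ‖bJ i.1‖ * ‖P'‖ ≤ β * 1 := mul_le_mul (hβ i) hnP' (norm_nonneg _) hβ0
          _ = β := mul_one β)
    have hsep : ∀ i ∈ S₀, ∀ l ∈ S₁, ∃ μ, (N : ℤ) ≤ |i.1 μ - l.1 μ| := by
      intro i hi l hl
      obtain ⟨-, hix⟩ := Finset.mem_filter.mp hi
      obtain ⟨-, x', hFx', hlx'⟩ := Finset.mem_filter.mp hl
      obtain ⟨μ, hμ⟩ := hD x' hFx'
      refine ⟨μ, ?_⟩
      have h1 : |pos x μ - M * i.1 μ| < 5 / 8 * M := hCube_ne_zero_imp hM hix μ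
      have h2 : |pos x' μ - M * l.1 μ| < 5 / 8 * M := hCube_ne_zero_imp hM hlx' μ
      have h3 : ((N : ℝ) + 5 / 4) * M ≤ |pos x μ - pos x' μ| := hND.trans hμ
      have htri : |pos x μ - pos x' μ| ≤ |pos x μ - M * i.1 μ| + |M * i.1 μ - M * l.1 μ| + |pos x' μ - M * l.1 μ| := by
        calc |pos x μ - pos x' μ|
            = |(pos x μ - M * i.1 μ) + (M * i.1 μ - M * l.1 μ) + (M * l.1 μ - pos x' μ)| := by ring_nf
          _ ≤ |pos x μ - M * i.1 μ| + |M * i.1 μ - M * l.1 μ| + |M * l.1 μ - pos x' μ| := abs_add_three _ _ _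
          _ = _ := by rw [abs_sub_comm (M * l.1 μ) (pos x' μ)]
      have h4 : (N : ℝ) * M < |M * i.1 μ - M * l.1 μ| := by linarith
      rw [← mul_sub, abs_mul, abs_of_pos hM] at h4
      have h5 : (N : ℝ) < |((i.1 μ : ℤ) : ℝ) - l.1 μ| := lt_of_mul_lt_mul_right (by linarith) hM.le
      have h6 : ((N : ℤ) : ℝ) < (|i.1 μ - l.1 μ| : ℤ) := by push_cast; exact h5
      exact (Int.cast_lt.mp h6).le
    have hcardS₀ : S₀.card ≤ 2 ^ d := by
      have hsub : S₀.map (Function.Embedding.subtype (· ∈ s))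
          ⊆ Fintype.piFinset fun μ => ({⌊pos x μ / M⌋, ⌊pos x μ / M⌋ + 1} : Finset ℤ) := by
        intro j hj
        obtain ⟨i, hi, rfl⟩ := Finset.mem_map.mp hj
        obtain ⟨-, hix⟩ := Finset.mem_filter.mp hi
        exact mem_box_of_hCube_ne_zero hix
      calc S₀.card = (S₀.map (Function.Embedding.subtype (· ∈ s))).card := (Finset.card_map _).symm
        _ ≤ _ := Finset.card_le_card hsub
        _ ≤ 2 ^ d := card_labelBox_le M (pos x)
    have hr : ((N : ℝ) + 1) - 2 ≤ ((N - 1 : ℕ) : ℝ) := by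
      rw [Nat.cast_sub hfar, Nat.cast_one]; linarith
    have hwalk := concrete_walk_decay_exp hM pos c m2 a q W T hc hq s hs S hS W' T' hWW' hTT' Gj hGj G hGH
      (P := P) (P' := P') (S₀ := S₀) (S₁ := S₁) (α := γ) (β := β) (β₁ := β) (N := N)
      hP hP'a hP'b hα hβ0 hβ hβ₁ h3β hfar hsep hr
    have hEN : Real.exp (-((N : ℝ) + 1)) ≤ Real.exp (-(D / M - 5 / 4)) := Real.exp_le_exp.mpr (by linarith)
    calc ‖P * G * P'‖ ≤ S₀.card * γ * β * (3 : ℝ) ^ d * (2 * Real.exp 2 * Real.exp (-((N : ℝ) + 1))) := hwalk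
      _ ≤ (2 : ℝ) ^ d * γ * β * (3 : ℝ) ^ d * (2 * Real.exp 2 * Real.exp (-(D / M - 5 / 4))) := by
          gcongr
          exact_mod_cast hcardS₀
      _ = (2 : ℝ) ^ d * γ * (((3 : ℝ) ^ d * β) * (2 * Real.exp 2 * Real.exp (-(D / M - 5 / 4)))) := by ring
      _ ≤ (2 : ℝ) ^ d * γ * (Real.exp (-1) * (2 * Real.exp 2 * Real.exp (-(D / M - 5 / 4)))) := by
          gcongr
      _ = 2 ^ (d + 1) * Real.exp (9 / 4) * γ * Real.exp (-(D / M)) := by rw [hexp]; ring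
  · -- NEAR THE SUPPORT (`D < (9/4)M`): the size of the Neumann series suffices
    rw [not_le, Nat.lt_one_iff, Nat.floor_eq_zero] at hfar
    have hE : 1 ≤ Real.exp (9 / 4) * Real.exp (-(D / M)) := by
      rw [← Real.exp_add]
      exact Real.one_le_exp_iff.mpr (by linarith)
    calc ‖P * G * P'‖ ≤ ‖P * G‖ * ‖P'‖ := norm_mul_le _ _
      _ ≤ (‖P‖ * ‖G‖) * ‖P'‖ := mul_le_mul_of_nonneg_right (norm_mul_le _ _) (norm_nonneg _)
      _ ≤ (1 * ((2 : ℝ) ^ (d + 1) * γ)) * 1 :=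
          mul_le_mul (mul_le_mul hnP hG (norm_nonneg _) zero_le_one) hnP' (norm_nonneg _)
            (by rw [one_mul]; exact mul_nonneg (by positivity) hγ0)
      _ = (2 : ℝ) ^ (d + 1) * γ * 1 := by ring
      _ ≤ (2 : ℝ) ^ (d + 1) * γ * (Real.exp (9 / 4) * Real.exp (-(D / M))) := by gcongr
      _ = 2 ^ (d + 1) * Real.exp (9 / 4) * γ * Real.exp (-(D / M)) := by ring

/-- **(1.10) AS PRINTED, value member: `|(G_k(Ω,A)f)(x)| ≤ c₀e^{−δ₀dist(x, supp f)}‖f‖_∞`** (`c₀ = 2^{d+1}e^{9/4}γ`,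
`δ₀ = M⁻¹`), for every `f` supported in `F` with `sup|f| ≤ φ` and every `D ≤ dist_∞(x, F)` — the `mulVec` form of
`ineq110_value`. [cite: Balaban1983RegularityDecay, Theorem (1.10) p.573] -/
theorem ineq110_value_apply {M : ℝ} (hM : 0 < M) (pos : X → Fin d → ℝ) (c : X → X → ℝ) (m2 a : ℝ)
    (q : Y → X → ℝ) (W : X → X → Matrix κ κ ℝ) (T : Y → X → Matrix κ κ ℝ)
    (hc : ∀ x z', c x z' ≠ 0 → ∀ μ, |pos x μ - pos z' μ| ≤ 1 / 8 * M)
    (hq : ∀ y x z', q y x ≠ 0 → q y z' ≠ 0 → ∀ μ, |pos x μ - pos z' μ| ≤ 1 / 8 * M)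
    (s : Finset (Fin d → ℤ)) (hs : ∀ j x, hCube M j (pos x) ≠ 0 → j ∈ s)
    (S : (Fin d → ℤ) → X → Prop) [∀ j, DecidablePred (S j)]
    (hS : ∀ j z, (∀ μ, |pos z μ - M * j μ| ≤ 7 / 8 * M) → S j z)
    (W' : (Fin d → ℤ) → X → X → Matrix κ κ ℝ) (T' : (Fin d → ℤ) → Y → X → Matrix κ κ ℝ)
    (hWW' : ∀ j x z', (∀ μ, |pos x μ - M * j μ| ≤ 3 / 4 * M) → (∀ μ, |pos z' μ - M * j μ| ≤ 3 / 4 * M) →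
      W' j x z' = W x z')
    (hTT' : ∀ j y x, q y x ≠ 0 → (∀ μ, |pos x μ - M * j μ| ≤ 3 / 4 * M) → T' j y x = T y x)
    (Gj : (Fin d → ℤ) → Matrix (X × κ) (X × κ) ℝ)
    (hGj : ∀ j ∈ s, covOp (fun z z' => if (S j z ↔ S j z') then c z z' else 0) m2 a q (W' j) (T' j) * Gj j = 1)
    (G : Matrix (X × κ) (X × κ) ℝ) (hGH : G * covOp c m2 a q W T = 1)
    {γ β : ℝ} (hγ0 : 0 ≤ γ) (hγ : ∀ i : ↥s, ‖Gj i.1‖ ≤ γ) (hβ0 : 0 ≤ β)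
    (hβ : ∀ i : ↥s, ‖opK (fun z z' => if (S i.1 z ↔ S i.1 z') then c z z' else 0) m2 a q (W' i.1) (T' i.1)
        (fun z => hCube M i.1 (pos z)) * Gj i.1 * mulH (ι := κ) (fun z => hCube M i.1 (pos z))‖ ≤ β)
    (h3β : (3 : ℝ) ^ d * β ≤ Real.exp (-1))
    (x : X) (F : X → Prop) [DecidablePred F] {D : ℝ} (hD : ∀ x', F x' → ∃ μ, D ≤ |pos x μ - pos x' μ|)
    (f : X × κ → ℝ) (hfF : ∀ p, ¬ F p.1 → f p = 0) {φ : ℝ} (hφ : 0 ≤ φ) (hf : ∀ p, |f p| ≤ φ) (k : κ) :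
    |(G *ᵥ f) (x, k)| ≤ 2 ^ (d + 1) * Real.exp (9 / 4) * γ * Real.exp (-(D / M)) * φ := by
  have hmain := ineq110_value hM pos c m2 a q W T hc hq s hs S hS W' T' hWW' hTT' Gj hGj G hGH hγ0 hγ hβ0 hβ h3β x F hD
  have hP'f : mulH (ι := κ) (fun z => if F z then (1 : ℝ) else 0) *ᵥ f = f := by
    ext p
    rw [mulH_mulVec_apply]
    by_cases hz : F p.1
    · rw [if_pos hz, one_mul]
    · rw [if_neg hz, zero_mul, hfF p hz]
  have hentry : ((mulH (ι := κ) (fun z => if z = x then (1 : ℝ) else 0) * G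
      * mulH (ι := κ) (fun z => if F z then (1 : ℝ) else 0)) *ᵥ f) (x, k) = (G *ᵥ f) (x, k) := by
    rw [← Matrix.mulVec_mulVec, ← Matrix.mulVec_mulVec, hP'f, mulH_mulVec_apply, if_pos rfl, one_mul]
  rw [← hentry]
  exact (abs_mulVec_le _ f hφ hf (x, k)).trans (mul_le_mul_of_nonneg_right hmain hφ)

/-- **(1.10) FOR THE KERNEL**: `|G_k(Ω,A; x, x′)| ≤ 2^{d+1}e^{9/4}γ·e^{−D/M}` for every `D ≤ |x − x′|_∞` (every colour
pair). [cite: Balaban1983RegularityDecay, Theorem (1.10) p.573] -/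
theorem kernel_decay_110 {M : ℝ} (hM : 0 < M) (pos : X → Fin d → ℝ) (c : X → X → ℝ) (m2 a : ℝ)
    (q : Y → X → ℝ) (W : X → X → Matrix κ κ ℝ) (T : Y → X → Matrix κ κ ℝ)
    (hc : ∀ x z', c x z' ≠ 0 → ∀ μ, |pos x μ - pos z' μ| ≤ 1 / 8 * M)
    (hq : ∀ y x z', q y x ≠ 0 → q y z' ≠ 0 → ∀ μ, |pos x μ - pos z' μ| ≤ 1 / 8 * M)
    (s : Finset (Fin d → ℤ)) (hs : ∀ j x, hCube M j (pos x) ≠ 0 → j ∈ s)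
    (S : (Fin d → ℤ) → X → Prop) [∀ j, DecidablePred (S j)]
    (hS : ∀ j z, (∀ μ, |pos z μ - M * j μ| ≤ 7 / 8 * M) → S j z)
    (W' : (Fin d → ℤ) → X → X → Matrix κ κ ℝ) (T' : (Fin d → ℤ) → Y → X → Matrix κ κ ℝ)
    (hWW' : ∀ j x z', (∀ μ, |pos x μ - M * j μ| ≤ 3 / 4 * M) → (∀ μ, |pos z' μ - M * j μ| ≤ 3 / 4 * M) →
      W' j x z' = W x z')
    (hTT' : ∀ j y x, q y x ≠ 0 → (∀ μ, |pos x μ - M * j μ| ≤ 3 / 4 * M) → T' j y x = T y x)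
    (Gj : (Fin d → ℤ) → Matrix (X × κ) (X × κ) ℝ)
    (hGj : ∀ j ∈ s, covOp (fun z z' => if (S j z ↔ S j z') then c z z' else 0) m2 a q (W' j) (T' j) * Gj j = 1)
    (G : Matrix (X × κ) (X × κ) ℝ) (hGH : G * covOp c m2 a q W T = 1)
    {γ β : ℝ} (hγ0 : 0 ≤ γ) (hγ : ∀ i : ↥s, ‖Gj i.1‖ ≤ γ) (hβ0 : 0 ≤ β)
    (hβ : ∀ i : ↥s, ‖opK (fun z z' => if (S i.1 z ↔ S i.1 z') then c z z' else 0) m2 a q (W' i.1) (T' i.1)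
        (fun z => hCube M i.1 (pos z)) * Gj i.1 * mulH (ι := κ) (fun z => hCube M i.1 (pos z))‖ ≤ β)
    (h3β : (3 : ℝ) ^ d * β ≤ Real.exp (-1))
    (x x' : X) (k k' : κ) {D : ℝ} (hD : ∃ μ, D ≤ |pos x μ - pos x' μ|) :
    |G (x, k) (x', k')| ≤ 2 ^ (d + 1) * Real.exp (9 / 4) * γ * Real.exp (-(D / M)) := by
  have hmain := ineq110_value hM pos c m2 a q W T hc hq s hs S hS W' T' hWW' hTT' Gj hGj G hGH hγ0 hγ hβ0 hβ h3β x (fun z => z = x') (D := D) (fun z hz => by subst hz; exact hD)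
  have hent : (mulH (ι := κ) (fun z => if z = x then (1 : ℝ) else 0) * G
      * mulH (ι := κ) (fun z => if z = x' then (1 : ℝ) else 0)) (x, k) (x', k') = G (x, k) (x', k') := by
    rw [mul_mulH_apply, mulH_mul_apply, if_pos rfl, if_pos rfl, one_mul, mul_one]
  rw [← hent]
  exact (entry_le_norm _ _ _).trans hmain

end Route

end Literature.MathematicalPhysics.QuantumFieldTheory.Balaban1983to89.B4Ineq110WalkRoute
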